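import Mathlib
import Literature.LinearAlgebra.Matrix.CommutatorNilpotent
import Summits.ValiantsHypothesis.ValiantsHypothesis.Theorems.GrenetZeonTwoDimCoefficientsDefs

/-!
# `GrenetZeon.DualUnipotentThreeHalves` (stmt-ValiantsHypothesis-24318) — line `radical_split`, stub R1
# `stub_radicalCoarsening`: BRICK 1, the TRACE-FORM / JACOBSON-RADICAL core

HONEST FRAMING.  Helper file (`--supports stmt-ValiantsHypothesis-24318 --as helper`; val-lit port pool, seat
val-port-3 g0; val-lit desk g12 RULING #271 (a′) / #272 (d)).  It proves the algebraic heart of the PAPER PROOF of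
R1 «radical coarsening» (`Cruxes/DualUnipotentThreeHalves/Lines/radical_split.lean`, val-idea-9 g3, card §2): the
trace-orthogonality hypothesis `RadOrth` puts the linear part of the pencil inside the (nilpotent) Jacobson radical of
the pencil algebra.  Nothing here proves R1 itself (the Loewy flag, its greedy coarsening and the dimension count are
NOT in this file), nothing bears on the rung `…Theses.GrenetZeon.DualUnipotentThreeHalves`, on 24318 / 8062, or on
`VP ≠ VNP` (NOT proved).  No definitions, no named facts.

CONTENTS.  For a subalgebra `𝒜 ⊆ M_m(ℂ)` and `a ∈ 𝒜` TRACE-ORTHOGONAL to `𝒜` (`tr(a·b) = 0` for all `b ∈ 𝒜`):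
* `isNilpotent_of_traceOrth` — `a` is nilpotent (all `tr(a^k)`, `k ≥ 1`, vanish; char `0`; the tree's
  `Literature.LinearAlgebra.Matrix.isNilpotent_of_forall_trace_pow_eq_zero`, Horn–Johnson 2.4.P10);
* `traceOrth_mul_right` / `traceOrth_mul_left` — trace-orthogonality is a two-sided ideal condition;
* `mem_jacobson_of_traceOrth` — `a` lies in the Jacobson radical `Ideal.jacobson ⊥` of the ring `↥𝒜`
  (`Ideal.mem_jacobson_bot`: `a·y + 1` is a unit for every `y ∈ 𝒜`, since `a·y` is trace-orthogonal, hence nilpotent);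
* `exists_jacobson_pow_eq_bot` — `𝒜` is Artinian (finite-dimensional over `ℂ`), so `(Ideal.jacobson ⊥)^L = ⊥` for
  some `L` (`IsArtinianRing.isNilpotent_jacobson_bot`), and `prod_eq_zero_of_mem_jacobson`: any product of `L`
  radical elements vanishes;
* the PENCIL specialisation (`AffMat n m` of `…GrenetZeonTwoDimCoefficientsDefs`; the line's `pencilAlg`, `linPart`,
  `RadOrth` UNFOLDED, since `Cruxes/` files are not importable): `eval_mem_pencilAdjoin`, `linPart_mem_pencilAdjoin`,
  `linPart_isNilpotent_of_radOrth`, `linPart_mem_jacobson_of_radOrth`.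
What R1 still needs (successor bricks, recorded here for the line holder): (B2) the Loewy flag `G_t = (rad 𝒜)^t ℂ^m`
as a `FlagAdapted` basis with `r = a = 0` ⇒ `FlagCheap` whenever `L·n < dim K` (fine flag); (B3) the greedy
coarsening with `λ = ⌊√n⌋` and the count `codim W ≤ 2mλ + 2λ²` (card §2) for the registered constant `16m⌊√n⌋ + 16n`.
[folklore] trace form and radical of a finite-dimensional algebra (e.g. Pierce, *Associative Algebras*, §4;
Herstein, *Noncommutative Rings*, Thm 1.3.1 for the nilpotency of the radical of an Artinian ring).
-/

-- `Summit.ValiantsHypothesis.ValiantsHypothesis.…` is the tree's mandated single-conjunct layout (Sub = Summit).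
set_option linter.dupNamespace false

noncomputable section

namespace Summit.ValiantsHypothesis.ValiantsHypothesis.Theorems.GrenetZeon.RadicalCoarsening

open Matrix
open scoped BigOperators

section Algebra

variable {m : ℕ} (𝒜 : Subalgebra ℂ (Matrix (Fin m) (Fin m) ℂ))

/-- A trace-orthogonal element of a matrix subalgebra is nilpotent: `a ∈ 𝒜`, `tr(a·b) = 0` for all `b ∈ 𝒜`
⇒ `a` nilpotent (take `b = a^{k-1}`; characteristic `0`). [folklore] -/
theorem isNilpotent_of_traceOrth {a : Matrix (Fin m) (Fin m) ℂ} (ha : a ∈ 𝒜)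
    (h : ∀ b ∈ 𝒜, Matrix.trace (a * b) = 0) : IsNilpotent a := by
  refine Literature.LinearAlgebra.Matrix.isNilpotent_of_forall_trace_pow_eq_zero a fun k hk _ => ?_
  obtain ⟨j, rfl⟩ := Nat.exists_eq_succ_of_ne_zero hk.ne'
  rw [pow_succ']
  exact h _ (Subalgebra.pow_mem 𝒜 ha j)

/-- Trace-orthogonality is stable under right multiplication by the algebra. [folklore] -/
theorem traceOrth_mul_right {a c : Matrix (Fin m) (Fin m) ℂ} (hc : c ∈ 𝒜)
    (h : ∀ b ∈ 𝒜, Matrix.trace (a * b) = 0) : ∀ b ∈ 𝒜, Matrix.trace (a * c * b) = 0 := by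
  intro b hb
  rw [Matrix.mul_assoc]
  exact h _ (Subalgebra.mul_mem 𝒜 hc hb)

/-- Trace-orthogonality is stable under left multiplication by the algebra (cyclicity of the trace). [folklore] -/
theorem traceOrth_mul_left {a c : Matrix (Fin m) (Fin m) ℂ} (hc : c ∈ 𝒜)
    (h : ∀ b ∈ 𝒜, Matrix.trace (a * b) = 0) : ∀ b ∈ 𝒜, Matrix.trace (c * a * b) = 0 := by
  intro b hb
  rw [Matrix.mul_assoc, Matrix.trace_mul_comm, Matrix.mul_assoc]
  exact h _ (Subalgebra.mul_mem 𝒜 hb hc)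

/-- A nilpotent matrix lying in `𝒜` is nilpotent as an element of the ring `↥𝒜`. [folklore] -/
theorem isNilpotent_subtype_of_isNilpotent {a : Matrix (Fin m) (Fin m) ℂ} (ha : a ∈ 𝒜) (hn : IsNilpotent a) :
    IsNilpotent (⟨a, ha⟩ : 𝒜) := by
  obtain ⟨k, hk⟩ := hn
  refine ⟨k, Subtype.ext ?_⟩
  rw [SubmonoidClass.coe_pow]
  exact hk

/-- **Trace-orthogonal ⇒ radical.**  A trace-orthogonal element of `𝒜` lies in the Jacobson radical of the ring `↥𝒜`:
for every `y ∈ 𝒜`, `a·y` is again trace-orthogonal, hence nilpotent, hence `a·y + 1` is a unit of `↥𝒜`. [folklore] -/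
theorem mem_jacobson_of_traceOrth {a : Matrix (Fin m) (Fin m) ℂ} (ha : a ∈ 𝒜)
    (h : ∀ b ∈ 𝒜, Matrix.trace (a * b) = 0) :
    (⟨a, ha⟩ : 𝒜) ∈ Ideal.jacobson (⊥ : Ideal 𝒜) := by
  rw [Ideal.mem_jacobson_iff]
  intro y
  have hya : IsNilpotent ((y : Matrix (Fin m) (Fin m) ℂ) * a) :=
    isNilpotent_of_traceOrth 𝒜 (Subalgebra.mul_mem 𝒜 y.2 ha) (traceOrth_mul_left 𝒜 y.2 h)
  have hya' : IsNilpotent (y * (⟨a, ha⟩ : 𝒜)) := by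
    have e : (y * (⟨a, ha⟩ : 𝒜)) = ⟨(y : Matrix (Fin m) (Fin m) ℂ) * a, Subalgebra.mul_mem 𝒜 y.2 ha⟩ :=
      Subtype.ext rfl
    rw [e]
    exact isNilpotent_subtype_of_isNilpotent 𝒜 (Subalgebra.mul_mem 𝒜 y.2 ha) hya
  obtain ⟨u, hu⟩ := hya'.isUnit_add_one
  refine ⟨(↑u⁻¹ : 𝒜), ?_⟩
  rw [Ideal.mem_bot]
  have hinv : (↑u⁻¹ : 𝒜) * (y * (⟨a, ha⟩ : 𝒜) + 1) = 1 := by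
    rw [← hu, Units.inv_mul]
  calc (↑u⁻¹ : 𝒜) * y * (⟨a, ha⟩ : 𝒜) + ↑u⁻¹ - 1
      = (↑u⁻¹ : 𝒜) * (y * (⟨a, ha⟩ : 𝒜) + 1) - 1 := by rw [mul_add, mul_one, mul_assoc]
    _ = 0 := by rw [hinv, sub_self]

/-- The subalgebra is finite-dimensional over `ℂ`, hence an Artinian ring. [folklore] -/
theorem isArtinianRing_subalgebra : IsArtinianRing 𝒜 := by
  haveI : Module.Finite ℂ 𝒜 := inferInstance
  exact IsArtinianRing.of_finite ℂ 𝒜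

/-- **The radical is nilpotent**: `(Ideal.jacobson ⊥)^L = ⊥` in the Artinian ring `↥𝒜` for some `L`. [folklore] -/
theorem exists_jacobson_pow_eq_bot : ∃ L : ℕ, (Ideal.jacobson (⊥ : Ideal 𝒜)) ^ L = ⊥ := by
  haveI := isArtinianRing_subalgebra 𝒜
  obtain ⟨L, hL⟩ := IsArtinianRing.isNilpotent_jacobson_bot (R := 𝒜)
  exact ⟨L, hL⟩

/-- A product of `L` elements of an ideal lies in its `L`-th power. [folklore] -/
theorem list_prod_mem_pow (I : Ideal 𝒜) :
    ∀ l : List 𝒜, (∀ x ∈ l, x ∈ I) → l.prod ∈ I ^ l.length := by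
  intro l
  induction l with
  | nil =>
    intro _
    rw [List.prod_nil, List.length_nil, Submodule.pow_zero, Submodule.one_eq_span]
    exact Submodule.mem_span_singleton_self 1
  | cons x l ih =>
    intro hl
    have hx : x ∈ I := hl x (by simp)
    have ih' : l.prod ∈ I ^ l.length := ih fun y hy => hl y (by simp [hy])
    rw [List.prod_cons, List.length_cons]
    rcases Nat.eq_zero_or_pos l.length with h0 | hpos
    · have hl0 : l = [] := List.eq_nil_of_length_eq_zero h0
      subst hl0
      rw [List.prod_nil, mul_one, List.length_nil, zero_add, Submodule.pow_one]
      exact hx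
    · rw [Submodule.pow_succ' I (Nat.pos_iff_ne_zero.1 hpos)]
      exact Submodule.mul_mem_mul hx ih'

/-- **Products of radical elements vanish**: with `L` as in `exists_jacobson_pow_eq_bot`, every product of `L`
elements of the radical of `↥𝒜` is `0` (as a matrix). [folklore] -/
theorem prod_eq_zero_of_mem_jacobson {L : ℕ} (hL : (Ideal.jacobson (⊥ : Ideal 𝒜)) ^ L = ⊥)
    (f : Fin L → 𝒜) (hf : ∀ i, f i ∈ Ideal.jacobson (⊥ : Ideal 𝒜)) :
    ((List.ofFn f).prod : 𝒜) = 0 := by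
  have hmem := list_prod_mem_pow 𝒜 (Ideal.jacobson (⊥ : Ideal 𝒜)) (List.ofFn f)
    (fun x hx => by
      obtain ⟨i, rfl⟩ := List.mem_ofFn.1 hx
      exact hf i)
  rw [List.length_ofFn, hL] at hmem
  exact (Submodule.mem_bot 𝒜).1 hmem

end Algebra

section Pencil

open Summit.ValiantsHypothesis.ValiantsHypothesis.Cruxes.TwoDimCoefficients.DimTwoCases (AffMat)

variable {n m : ℕ} (N : AffMat n m)

/-- Every value `N(x)` of the pencil lies in the pencil algebra `𝒜(N) = Algebra.adjoin ℂ {N(x) : x}` (the line's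
`pencilAlg`, unfolded). [folklore] -/
theorem eval_mem_pencilAdjoin (x : Fin n × Fin n → ℂ) :
    N.map (MvPolynomial.eval x) ∈
      Algebra.adjoin ℂ (Set.range fun y : Fin n × Fin n → ℂ => N.map (MvPolynomial.eval y)) :=
  Algebra.subset_adjoin ⟨x, rfl⟩

/-- The linear part `N(v) − N(0)` (the line's `linPart`, unfolded) lies in the pencil algebra. [folklore] -/
theorem linPart_mem_pencilAdjoin (v : Fin n × Fin n → ℂ) :
    N.map (MvPolynomial.eval v) - N.map (MvPolynomial.eval 0) ∈
      Algebra.adjoin ℂ (Set.range fun y : Fin n × Fin n → ℂ => N.map (MvPolynomial.eval y)) :=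
  Subalgebra.sub_mem _ (eval_mem_pencilAdjoin N v) (eval_mem_pencilAdjoin N 0)

/-- **`RadOrth` ⇒ nilpotent linear parts.**  If the direction space `K` is trace-orthogonal to the pencil algebra
(the line's `RadOrth n m N K`, unfolded), then `N(v) − N(0)` is nilpotent for every `v ∈ K`. [folklore] -/
theorem linPart_isNilpotent_of_radOrth (K : Submodule ℂ (Fin n × Fin n → ℂ))
    (hK : ∀ v ∈ K, ∀ b ∈ Algebra.adjoin ℂ (Set.range fun y : Fin n × Fin n → ℂ => N.map (MvPolynomial.eval y)),
      Matrix.trace ((N.map (MvPolynomial.eval v) - N.map (MvPolynomial.eval 0)) * b) = 0)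
    {v : Fin n × Fin n → ℂ} (hv : v ∈ K) :
    IsNilpotent (N.map (MvPolynomial.eval v) - N.map (MvPolynomial.eval 0)) :=
  isNilpotent_of_traceOrth _ (linPart_mem_pencilAdjoin N v) (hK v hv)

/-- **`RadOrth` ⇒ radical linear parts.**  Under `RadOrth` (unfolded), `N(v) − N(0)` lies in the Jacobson radical of
the pencil algebra for every `v ∈ K`; with `exists_jacobson_pow_eq_bot` / `prod_eq_zero_of_mem_jacobson` every product
of `L` such linear parts (interleaved with arbitrary elements of the algebra, the radical being an ideal) vanishes —
the mechanism behind the Loewy-flag degree bound of R1. [folklore] -/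
theorem linPart_mem_jacobson_of_radOrth (K : Submodule ℂ (Fin n × Fin n → ℂ))
    (hK : ∀ v ∈ K, ∀ b ∈ Algebra.adjoin ℂ (Set.range fun y : Fin n × Fin n → ℂ => N.map (MvPolynomial.eval y)),
      Matrix.trace ((N.map (MvPolynomial.eval v) - N.map (MvPolynomial.eval 0)) * b) = 0)
    {v : Fin n × Fin n → ℂ} (hv : v ∈ K) :
    (⟨N.map (MvPolynomial.eval v) - N.map (MvPolynomial.eval 0), linPart_mem_pencilAdjoin N v⟩ :
        Algebra.adjoin ℂ (Set.range fun y : Fin n × Fin n → ℂ => N.map (MvPolynomial.eval y))) ∈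
      Ideal.jacobson (⊥ : Ideal (Algebra.adjoin ℂ (Set.range fun y : Fin n × Fin n → ℂ => N.map (MvPolynomial.eval y)))) :=
  mem_jacobson_of_traceOrth _ (linPart_mem_pencilAdjoin N v) (hK v hv)

end Pencil

end Summit.ValiantsHypothesis.ValiantsHypothesis.Theorems.GrenetZeon.RadicalCoarsening

end
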